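import Summits.FinalStateConjecture.FinalStateConjecture.Theorems.KappaExplicitWaveDecay.Negative.FalseWithoutWaveEq

/-!
# `KappaExplicitWaveDecay` (crux `stmt-FinalStateConjecture-10654`, route `PhaseMixingCapture`):
# the wave equation is load-bearing in the integrated-decay conjunct too (negative-side support)

Companion of `FalseWithoutWaveEq.lean` (conjunct (a)). Here conjunct (b) of the crux — κ-explicit
integrated local energy decay `∫₀^∞ E_loc(τ, R) dτ ≤ C(M,R) (1-(a/M)²)^(-p) E_j[ψ](0)` — with the
clause `∀ x, □_g ψ x = 0` deleted from the admissibility hypothesis (statement written inline) is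
shown FALSE, sorry-free, with the same witness `Witness.psi = expNegInvGlue (t* - 1/3)` on the
Schwarzschild exterior `M = 1, a = 0`: its data vanish identically near `{t* = 0}` (RHS `= 0` for
every `(p, j, C)`), while `∫₀^∞ E_loc(τ, 3) dτ > 0`, because `ψ' > 0` on an interval around the
mean-value time `τ₀` (continuity of `ψ'`) and the shell `{2 < ‖y‖ ≤ 3}` of the leaf has positive
volume. Moral as before: only `□ψ = 0` ties `ψ` at `t* > 0` to its data.
-/

noncomputable section

namespace Summit.FinalStateConjecture.FinalStateConjecture.Theorems.KappaExplicitWaveDecay.Negative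

open Literature.Geometry.Lorentzian
open scoped Manifold ENNReal Topology ContDiff
open Filter Set MeasureTheory

namespace Witness

/-- `prof'` is continuous. [folklore] -/
theorem continuous_deriv_prof : Continuous (deriv prof) :=
  prof_contDiff.continuous_deriv (by simp)

/-- From a time of positivity of `prof'` to an interval on which `prof' ≥ prof'(τ₀)/2`. [folklore] -/
theorem exists_Ioo_deriv_prof_ge {τ₀ : ℝ} (hτ₀ : 0 ≤ τ₀) (h : 0 < deriv prof τ₀) :
    ∃ τ₁ τ₂ : ℝ, 0 ≤ τ₁ ∧ τ₁ < τ₂ ∧ ∀ τ ∈ Ioo τ₁ τ₂, deriv prof τ₀ / 2 ≤ deriv prof τ := by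
  have hev : ∀ᶠ τ in 𝓝 τ₀, deriv prof τ₀ / 2 < deriv prof τ :=
    continuous_deriv_prof.continuousAt.eventually (lt_mem_nhds (by linarith))
  obtain ⟨ε, hε, hball⟩ := Metric.eventually_nhds_iff.1 hev
  refine ⟨τ₀, τ₀ + ε / 2, hτ₀, by linarith, fun τ hτ ↦ le_of_lt (hball ?_)⟩
  rw [Real.dist_eq, abs_lt]
  constructor <;> linarith [hτ.1, hτ.2]

/-- Positivity of a set-`lintegral` over `(0, ∞)` from a uniform lower bound on a subinterval.
[folklore] -/
theorem setLIntegral_Ioi_pos {F : ℝ → ℝ≥0∞} {τ₁ τ₂ : ℝ} (h₁ : 0 ≤ τ₁) (h12 : τ₁ < τ₂) {c : ℝ≥0∞}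
    (hc : c ≠ 0) (hF : ∀ τ ∈ Ioo τ₁ τ₂, c ≤ F τ) : 0 < ∫⁻ τ in Ioi (0 : ℝ), F τ := by
  have hsub : Ioo τ₁ τ₂ ⊆ Ioi (0 : ℝ) := fun τ hτ ↦ lt_of_le_of_lt h₁ hτ.1
  have hle : (Ioo τ₁ τ₂).indicator (fun _ ↦ c) ≤ fun τ ↦ F τ := by
    intro τ
    by_cases hτ : τ ∈ Ioo τ₁ τ₂
    · rw [Set.indicator_of_mem hτ]; exact hF τ hτ
    · rw [Set.indicator_of_notMem hτ]; exact zero_le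
  calc (0 : ℝ≥0∞) < c * volume (Ioo τ₁ τ₂) := by
        refine ENNReal.mul_pos hc ?_
        rw [Real.volume_Ioo]; exact (ENNReal.ofReal_pos.2 (by linarith)).ne'
    _ = ∫⁻ τ in Ioi (0 : ℝ), (Ioo τ₁ τ₂).indicator (fun _ ↦ c) τ := by
        rw [lintegral_indicator_const measurableSet_Ioo, Measure.restrict_apply measurableSet_Ioo,
          Set.inter_eq_self_of_subset_left hsub]
    _ ≤ ∫⁻ τ in Ioi (0 : ℝ), F τ := lintegral_mono hle

/-- The shell `{2 < ‖y‖} ∩ closedBall 0 3` of the leaf has positive volume. [folklore] -/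
theorem volume_shell_pos :
    0 < volume ({y : E3 | 2 < ‖y‖} ∩ Metric.closedBall (0 : E3) 3) := by
  have hopen : IsOpen ({y : E3 | 2 < ‖y‖} ∩ Metric.ball (0 : E3) 3) :=
    (isOpen_lt continuous_const continuous_norm).inter Metric.isOpen_ball
  have hne : ({y : E3 | 2 < ‖y‖} ∩ Metric.ball (0 : E3) 3).Nonempty := by
    refine ⟨EuclideanSpace.single 0 (5 / 2), ?_, ?_⟩
    · rw [Set.mem_setOf_eq, EuclideanSpace.single, PiLp.norm_single, Real.norm_eq_abs]; norm_num
    · rw [Metric.mem_ball, dist_zero_right, EuclideanSpace.single, PiLp.norm_single,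
        Real.norm_eq_abs]; norm_num
  exact (hopen.measure_pos volume hne).trans_le
    (measure_mono (Set.inter_subset_inter_right _ Metric.ball_subset_closedBall))

/-- Local energy of the witness in the ball of radius `3`: at least `prof'(τ)²` times the volume of
the shell `{2 < ‖y‖ ≤ 3}`. [folklore] -/
theorem localSliceEnergy_ge (τ : ℝ) :
    ENNReal.ofReal (deriv prof τ ^ 2) * volume ({y : E3 | 2 < ‖y‖} ∩ Metric.closedBall (0 : E3) 3) ≤
      localSliceEnergy (Kerr.exterior 1 0) psi τ 3 := by
  unfold localSliceEnergy
  have hS : MeasurableSet {y : E3 | E4.ofTimeSpace τ y ∈ Kerr.exterior 1 0} :=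
    ((Kerr.exterior 1 0).isOpen.preimage (E4.continuous_ofTimeSpace τ)).measurableSet
  have hle : {y : E3 | E4.ofTimeSpace τ y ∈ Kerr.exterior 1 0}.indicator
      (fun _ ↦ ENNReal.ofReal (deriv prof τ ^ 2)) ≤
      {y : E3 | E4.ofTimeSpace τ y ∈ Kerr.exterior 1 0}.indicator
      (fun y ↦ ENNReal.ofReal (coordEnergyDensity (Kerr.exterior 1 0) psi (E4.ofTimeSpace τ y))) := by
    intro y
    by_cases hy : E4.ofTimeSpace τ y ∈ Kerr.exterior 1 0
    · have hy' : y ∈ {y : E3 | E4.ofTimeSpace τ y ∈ Kerr.exterior 1 0} := hy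
      rw [Set.indicator_of_mem hy', Set.indicator_of_mem hy']
      exact ENNReal.ofReal_le_ofReal (coordEnergyDensity_ge hy)
    · have hy' : y ∉ {y : E3 | E4.ofTimeSpace τ y ∈ Kerr.exterior 1 0} := hy
      rw [Set.indicator_of_notMem hy', Set.indicator_of_notMem hy']
  refine le_trans (le_of_eq ?_) (lintegral_mono hle)
  rw [lintegral_indicator_const hS, Measure.restrict_apply hS, sliceSet_eq]

/-- The integrated local energy `∫₀^∞ E_loc(τ, 3) dτ` of the witness is positive. [folklore] -/
theorem integratedLocalEnergy_pos {τ₀ : ℝ} (hτ₀ : 0 ≤ τ₀) (h : 0 < deriv prof τ₀) :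
    0 < ∫⁻ τ in Ioi (0 : ℝ), localSliceEnergy (Kerr.exterior 1 0) psi τ 3 := by
  obtain ⟨τ₁, τ₂, h₁, h12, hge⟩ := exists_Ioo_deriv_prof_ge hτ₀ h
  refine setLIntegral_Ioi_pos h₁ h12 (c := ENNReal.ofReal ((deriv prof τ₀ / 2) ^ 2) *
    volume ({y : E3 | 2 < ‖y‖} ∩ Metric.closedBall (0 : E3) 3)) ?_ fun τ hτ ↦ ?_
  · exact (ENNReal.mul_pos (ENNReal.ofReal_pos.2 (by positivity)).ne' volume_shell_pos.ne').ne'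
  · refine le_trans ?_ (localSliceEnergy_ge τ)
    have h2 : 0 ≤ deriv prof τ₀ / 2 := by linarith
    exact mul_le_mul_of_nonneg_right (ENNReal.ofReal_le_ofReal (pow_le_pow_left₀ h2 (hge τ hτ) 2))
      zero_le

end Witness

open Witness in
/-- **The wave equation is load-bearing in conjunct (b) of `KappaExplicitWaveDecay`.** The
integrated-decay conjunct with the clause `□_g ψ = 0` deleted (otherwise verbatim) is false: on
Schwarzschild `(M, a) = (1, 0)`, for every `(p, j)`, at `R = 3` and for every `C`, the witness
`Witness.psi` has RHS `= 0` and `∫₀^∞ E_loc(τ, 3) dτ > 0`. [folklore] -/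
theorem kappaExplicitWaveDecay_iled_false_without_waveEq : ¬ (
    ∀ M : ℝ, 0 < M → ∃ (p : ℝ) (j : ℕ), ∀ R : ℝ, ∃ C : ENNReal, C < ⊤ ∧ ∀ a : ℝ, Literature.Geometry.Lorentzian.Kerr.IsSubextremal M a → ∀ ψ : Literature.Geometry.Lorentzian.Kerr.exterior M a → ℝ, (ContMDiff 𝓘(ℝ, Literature.Geometry.Lorentzian.E4) 𝓘(ℝ, ℝ) ((⊤ : ℕ∞) : WithTop ℕ∞) ψ ∧ ∃ K : Set (Literature.Geometry.Lorentzian.Kerr.exterior M a), IsCompact K ∧ ∀ x : Literature.Geometry.Lorentzian.Kerr.exterior M a, (x : Literature.Geometry.Lorentzian.E4) 0 = 0 → x ∉ K → ψ x = 0 ∧ mfderiv 𝓘(ℝ, Literature.Geometry.Lorentzian.E4) 𝓘(ℝ, ℝ) ψ x = 0) → ∫⁻ τ in Ioi (0 : ℝ), Literature.Geometry.Lorentzian.localSliceEnergy (Literature.Geometry.Lorentzian.Kerr.exterior M a) ψ τ R ≤ C * ENNReal.ofReal ((1 - (a / M) ^ 2) ^ (-p)) * ∫⁻ y : Literature.Geometry.Lorentzian.E3,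 {y | Literature.Geometry.Lorentzian.E4.ofTimeSpace 0 y ∈ Literature.Geometry.Lorentzian.Kerr.exterior M a}.indicator (fun y ↦ ENNReal.ofReal (∑ m ∈ Finset.range (j + 1), ‖iteratedFDeriv ℝ m (Function.extend Subtype.val ψ (0 : Literature.Geometry.Lorentzian.E4 → ℝ)) (Literature.Geometry.Lorentzian.E4.ofTimeSpace 0 y)‖ ^ 2)) y) := by
  intro h
  obtain ⟨p, j, hB⟩ := h 1 one_pos
  obtain ⟨C, -, hC⟩ := hB 3
  obtain ⟨τ₀, hτ₀, hder⟩ := exists_deriv_prof_pos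
  have key := hC 0 (by norm_num [Kerr.IsSubextremal]) psi psi_smooth_and_compactData
  rw [initEnergy_psi_eq_zero j, mul_zero] at key
  exact (integratedLocalEnergy_pos hτ₀ hder).ne' (le_zero_iff.mp key)

end Summit.FinalStateConjecture.FinalStateConjecture.Theorems.KappaExplicitWaveDecay.Negative

end
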